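import Literature.Analysis.FluidPDE.NSLerayHopfSereginEnergyProofs
import HarnessLib

/-!
# Route FrozenSignCascade · crux `BoundedEnvelopeContinuation` — stub `stub_stateOfKato`

Helper file for statement item stmt-NavierStokesRegularity-10579 (`BoundedEnvelopeContinuation`,
conjunct (B) of route `FrozenSignCascade`); lands `--supports` that item (line `registered`,
stub `stub_stateOfKato` of the skeleton `Cruxes/BoundedEnvelopeContinuation/Lines/birth.lean`).

**`C([0, T'); L³)` is a regularity class, local form, with the Fourier side exposed.** For
`ν > 0`, a smooth, divergence-free, rapidly decaying datum `u₀`, a Kato solution `w` on `[0, T')`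
and `0 < Tt < T'`, there is a Tao-class solution `(u, p)` from `u₀` on `[0, Tt] × ℝ³` TOGETHER
WITH its Fourier side `V`: Fourier-mild of order `4` on `[0, Tt]` (`IsFourierMild (4π²ν) 4 0 Tt V`),
`u t = synthVel (V t)` on `[0, Tt]`, `V 0 = fourierData hu hd`. This is the tree theorem
`Literature.Analysis.FluidPDE.exists_isTaoSolutionOn_of_isKatoSolutionOn`
(`NSLerayHopfSereginEnergyProofs.lean`) verbatim — its restart induction already carries the state
`(u, p, V)` — returning the whole state restricted to `[0, Tt]` instead of `(u, p)` only.

References: P. G. Lemarié-Rieusset, *The Navier–Stokes Problem in the 21st Century* (2016),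
Prop. 12.3 (von Wahl), Thm. 7.2, Thm. 7.7; T. Kato, Math. Z. 187 (1984), Thm. 4.
-/

noncomputable section

set_option linter.dupNamespace false -- nested layout Summit.<S>.<Sub>, Sub = S (D-0017)

open MeasureTheory Set Function Filter Topology Real Complex FourierTransform InnerProductSpace
open scoped ENNReal NNReal ContDiff FourierTransform ComplexConjugate Laplacian

namespace Summit.NavierStokesRegularity.NavierStokesRegularity.Theorems.BoundedEnvelope

open Literature.Analysis.FluidPDE Literature.Analysis.FluidPDE.FourierNS

-- adapted from Literature/Analysis/FluidPDE/NSLerayHopfSereginEnergyProofs.lean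
-- (exists_isTaoSolutionOn_of_isKatoSolutionOn): same restart induction, whole state returned.
/-- **`C([0, T); L³)` is a regularity class, local form, with the Fourier side** (von Wahl 1985;
Lemarié-Rieusset 2016, Prop. 12.3, 4th item, with Thm. 7.2 and Thm. 7.7; Kato 1984, Thm. 4).
For `ν > 0`, a smooth, divergence-free, rapidly decaying datum `u₀`, a Kato solution `w` on
`[0, T')` (`IsKatoSolutionOn`) and every `0 < Tt < T'`, there is a Tao-class solution `(u, p)`
from `u₀` on the closed slab `[0, Tt] × ℝ³` (`IsTaoSolutionOn`) together with a Fourier-side mild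
solution `V` of order `4` on `[0, Tt]` (`IsFourierMild (4π²ν) 4 0 Tt V`) synthesising to it,
`u t = synthVel (V t)` for `t ∈ [0, Tt]`, and starting from the Fourier datum,
`V 0 = fourierData hu hd`. The proof is the restart induction of
`exists_isTaoSolutionOn_of_isKatoSolutionOn` verbatim, run on `[0, Tw]`, `Tw = (Tt + T')/2 < T'`:
along the induction the Tao-class solution on `[0, F]`, `F ≤ Tw`, agrees a.e. with `w`
(`IsTaoSolutionOn.ae_eq_of_kato_Icc`), whose `L³` tails are uniformly small on the compact
`[0, Tw]`, so the enstrophy inequality under splitting bounds the energy and the `L²_t H²_x`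
dissipation in terms of `u₀` (`IsTaoSolutionOn.lintegral_laplacian_sq_le_of_tails`), Plancherel
transports the bounds to the Fourier side (`IsFourierMild.dissip_le_of_synthVel`), Leray's
doubling argument (`FourierNS.exists_window_of_energy_dissip`) bounds the order-`4` Fourier
weights, and the Fourier–Picard restart piece (`exists_isTaoSolutionOn_fourierPiece`) has a
uniform lifespan; finitely many restarts glued by `IsTaoSolutionOn.glue` / `IsFourierMild.glue`
cover `[0, Tt]`; the state `(u, p, V)` of the induction is returned, restricted to `[0, Tt]`.
[cite: LemarieRieusset2016, Prop. 12.3 (von Wahl) with Thm. 7.2 and Thm. 7.7, PDF pp. 147, 169, 393] -/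
theorem stub_stateOfKato :
    ∀ ν : ℝ, 0 < ν → ∀ (u₀ : EuclideanSpace ℝ (Fin 3) → EuclideanSpace ℝ (Fin 3))
      (hu : ContDiff ℝ (⊤ : ℕ∞) u₀) (hd : Literature.Analysis.FluidPDE.HasRapidSpatialDecay u₀),
      Literature.Analysis.FluidPDE.NSWave0.IsDivFree u₀ →
      ∀ (T' : ℝ) (w : ℝ → EuclideanSpace ℝ (Fin 3) → EuclideanSpace ℝ (Fin 3)),
        Literature.Analysis.FluidPDE.IsKatoSolutionOn T' ν u₀ w → ∀ Tt : ℝ, 0 < Tt → Tt < T' →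
        ∃ (u : ℝ → EuclideanSpace ℝ (Fin 3) → EuclideanSpace ℝ (Fin 3))
          (p : ℝ → EuclideanSpace ℝ (Fin 3) → ℝ) (V : ℝ → EuclideanSpace ℝ (Fin 3) → Fin 3 → ℂ),
          Literature.Analysis.FluidPDE.IsTaoSolutionOn Tt ν u₀ u p ∧
          Literature.Analysis.FluidPDE.FourierNS.IsFourierMild (4 * Real.pi ^ 2 * ν) 4 0 Tt V ∧
          (∀ t ∈ Set.Icc 0 Tt, u t = Literature.Analysis.FluidPDE.FourierNS.synthVel (V t)) ∧
          V 0 = Literature.Analysis.FluidPDE.FourierNS.fourierData hu hd := by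
  intro ν hν u₀ hsm hdec hdiv T' w hw Tt hTt hTtT'
  set Tw : ℝ := (Tt + T') / 2 with hTw
  have hTtw : Tt < Tw := by rw [hTw]; linarith
  have hTwT' : Tw < T' := by rw [hTw]; linarith
  have hTw0 : 0 < Tw := hTt.trans hTtw
  /- the Kato solution on the closed sub-slabs `[0, F]`, `F ≤ Tw < T'` -/
  have hwmild : ∀ F : ℝ, F ≤ Tw → IsMildNSSolutionOn (Ico 0 F) ν 0 u₀ w := fun F hF =>
    hw.mild.mono (Ico_subset_Ico_right (hF.trans hTwT'.le))
  have hwc : ∀ F : ℝ, F ≤ Tw → ContinuousInLpOn (Icc 0 F) 3 w := fun F hF =>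
    hw.continuousInLpOn.mono fun t ht => ⟨ht.1, lt_of_le_of_lt (ht.2.trans hF) hTwT'⟩
  have hwm : ∀ F : ℝ, F ≤ Tw →
      AEStronglyMeasurable (uncurry w) (volume.restrict (Ioo 0 F ×ˢ univ)) := fun F hF =>
    hw.aestronglyMeasurable.mono_measure (Measure.restrict_mono
      (Set.prod_mono (Ioo_subset_Ioo_right (hF.trans hTwT'.le)) Subset.rfl) le_rfl)
  /- the splitting threshold `8 (δK)² ≤ ν²` and the `L³` tails of `w` on `[0, Tw]` -/
  set Ks : ℝ := (SNormLESNormFDerivOfEqConst (EuclideanSpace ℝ (Fin 3))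
    (volume : Measure (EuclideanSpace ℝ (Fin 3))) 2 : ℝ) with hKs
  have hKs0 : 0 ≤ Ks := NNReal.coe_nonneg _
  set δ : ℝ := ν / (4 * (Ks + 1)) with hδdef
  have hδ0 : 0 < δ := by positivity
  have hδK : δ * Ks ≤ ν / 4 := by
    rw [hδdef, div_mul_eq_mul_div, div_le_div_iff₀ (by positivity) (by positivity)]
    nlinarith [hν]
  have hδ8 : 8 * (δ * Ks) ^ 2 ≤ ν ^ 2 := by nlinarith [hδK, mul_nonneg hδ0.le hKs0]
  obtain ⟨lam, hlam⟩ := (hwc Tw le_rfl).exists_forall_eLpNorm_indicator_le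
    isCompact_Icc (by norm_num : (1 : ℝ≥0∞) ≤ 3) (by norm_num) hδ0
  set M : ℝ := max (lam : ℝ) 1 with hM
  have hMpos : 0 < M := lt_of_lt_of_le one_pos (le_max_right _ _)
  /- energy and enstrophy of the datum -/
  set e₀ : ℝ := 2 * VectorCalculus.kineticEnergy u₀ with he₀
  have he₀0 : 0 ≤ e₀ := mul_nonneg zero_le_two (kineticEnergy_nonneg _)
  have hHinf : ∀ n : ℕ, ∫⁻ x, ‖iteratedFDeriv ℝ n u₀ x‖ₑ ^ 2 < ⊤ :=
    hdec.lintegral_enorm_iteratedFDeriv_sq_lt_top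
  have hG₀ : ∫⁻ x, ENNReal.ofReal (frobeniusNormSq (fderiv ℝ u₀ x)) < ⊤ := by
    calc ∫⁻ x, ENNReal.ofReal (frobeniusNormSq (fderiv ℝ u₀ x))
        ≤ ∫⁻ x, 3 * ‖iteratedFDeriv ℝ 1 u₀ x‖ₑ ^ 2 := lintegral_mono fun x => by
          rw [← ofReal_norm, norm_iteratedFDeriv_one, ofReal_norm]
          exact ofReal_frobeniusNormSq_le_three_mul_enorm_sq _
      _ = 3 * ∫⁻ x, ‖iteratedFDeriv ℝ 1 u₀ x‖ₑ ^ 2 := lintegral_const_mul' _ _ (by simp)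
      _ < ⊤ := ENNReal.mul_lt_top (by simp) (hHinf 1)
  set g₀ : ℝ := (∫⁻ x, ENNReal.ofReal (frobeniusNormSq (fderiv ℝ u₀ x))).toReal with hg₀
  have hg₀0 : 0 ≤ g₀ := ENNReal.toReal_nonneg
  have hg₀eq : ∫⁻ x, ENNReal.ofReal (frobeniusNormSq (fderiv ℝ u₀ x)) = ENNReal.ofReal g₀ := by
    rw [hg₀, ENNReal.ofReal_toReal hG₀.ne]
  /- the dissipation budget -/
  set κw : ℝ := ν⁻¹ * (1 + 4 * M ^ 2 * Tw / ν * Real.exp (2 * M ^ 2 * Tw / ν)) with hκw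
  have hκw0 : 0 ≤ κw := by positivity
  set D : ℝ := ((2 * π) ^ 4)⁻¹ * (κw * g₀) with hD
  have hD0 : 0 ≤ D := by positivity
  /- the heat rate, the order, the window, the initial Fourier datum -/
  set cF : ℝ := 4 * π ^ 2 * ν with hcF
  have hcF0 : 0 < cF := by positivity
  have hι : Fintype.card (Fin 3) < 4 := by simp
  obtain ⟨τw, hτw, hwindow⟩ := exists_window_of_energy_dissip (ι := Fin 3) hι hcF0
    (Fintype.card (Fin 3) + 1) he₀0 hD0
  set a₀ : EuclideanSpace ℝ (Fin 3) → Fin 3 → ℂ := fourierData hsm hdec with ha₀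
  obtain ⟨A₀, hA₀⟩ := hasDecay_fourierData hsm hdec (Fintype.card (Fin 3) + 1)
  have hA₀0 : 0 ≤ A₀ := hA₀.nonneg
  set Aunif : ℝ := 2 ^ ⌈Tw / τw⌉₊ * A₀ with hAunif
  have hAunif0 : 0 ≤ Aunif := by positivity
  set TP : ℝ := picardTime (Fin 3) cF (Fintype.card (Fin 3) + 1) (2 * Aunif) with hTP
  have hTPpos : 0 < TP := picardTime_pos hcF0 _ _ (by positivity)
  have hdiv' : ∀ ξ : EuclideanSpace ℝ (Fin 3), ∑ l, (ξ l : ℂ) * a₀ ξ l = 0 :=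
    sum_mul_fourierData hsm hdec hdiv
  have hconj₀ : ∀ ξ l, a₀ (-ξ) l = conj (a₀ ξ l) := fourierData_conj_symm hsm hdec
  have hsynth₀ : synthVel a₀ = u₀ := by
    funext x
    ext l
    rw [synthVel_apply, show (fun ξ => a₀ ξ l) = fun ξ => fourierData hsm hdec ξ l from rfl,
      fourier_fourierData hsm hdec l]
    simp
  /- the state of the induction -/
  set State : ℝ → (ℝ → EuclideanSpace ℝ (Fin 3) → EuclideanSpace ℝ (Fin 3)) →
      (ℝ → EuclideanSpace ℝ (Fin 3) → ℝ) → (ℝ → EuclideanSpace ℝ (Fin 3) → Fin 3 → ℂ) → Prop :=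
    fun F u p V => IsTaoSolutionOn F ν u₀ u p ∧
      IsFourierMild cF (Fintype.card (Fin 3) + 1) 0 F V ∧
      (∀ t ∈ Icc 0 F, u t = synthVel (V t)) ∧ V 0 = a₀ with hState
  /- uniform bounds for a state on `[0, F]`, `F ≤ Tw`: energy, dissipation, weights -/
  have hbounds : ∀ ⦃F : ℝ⦄ ⦃u : ℝ → EuclideanSpace ℝ (Fin 3) → EuclideanSpace ℝ (Fin 3)⦄
      ⦃p : ℝ → EuclideanSpace ℝ (Fin 3) → ℝ⦄ ⦃V : ℝ → EuclideanSpace ℝ (Fin 3) → Fin 3 → ℂ⦄,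
      0 < F → F ≤ Tw → State F u p V →
        ∀ t' ∈ Icc 0 F, HasDecay (Fintype.card (Fin 3) + 1) Aunif (V t') := by
    intro F u p V hF hFw hS t' ht'
    obtain ⟨h, hV, hsyn, hV0⟩ := hS
    -- identification with the Kato solution and the `L³` tails
    have hae : ∀ s ∈ Icc 0 F, u s =ᵐ[volume] w s :=
      h.ae_eq_of_kato_Icc hν hF (hwmild F hFw) (hwc F hFw) (hwm F hFw)
    have htail : ∀ s ∈ Icc 0 F,
        eLpNorm ({x | lam ≤ ‖w s x‖₊}.indicator (w s)) 3 volume ≤ ENNReal.ofReal δ :=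
      fun s hs => hlam s ⟨hs.1, hs.2.trans hFw⟩
    -- energy of the Fourier side
    have hE : ∀ r ∈ Icc 0 F, ∫⁻ η, ‖V r η‖ₑ ^ 2 ≤ ENNReal.ofReal e₀ := by
      intro r hr
      have hdecr : ∀ K : ℕ, ∃ B, HasDecay K B (V r) := fun K => by
        obtain ⟨B, hB⟩ := hV.decay K
        exact ⟨B, hB r⟩
      calc ∫⁻ η, ‖V r η‖ₑ ^ 2 ≤ ∫⁻ x, ‖synthVel (V r) x‖ₑ ^ 2 :=
            lintegral_enorm_sq_le_of_synthVel (V r) (hV.continuous_slice r) hdecr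
              (fun ξ l => hV.conjSymm r ξ l)
        _ = ∫⁻ x, ‖u r x‖ₑ ^ 2 := by rw [hsyn r hr]
        _ ≤ ENNReal.ofReal e₀ := h.lintegral_enorm_sq_le hF hν.le hr
    -- dissipation of the Fourier side
    have hDis : dissip V 0 F ≤ ENNReal.ofReal D := by
      have h1 : ∀ r ∈ Icc 0 F, ∫⁻ x, ‖iteratedFDeriv ℝ 1 (u r) x‖ₑ ^ 2 < ⊤ := fun r hr =>
        (h.slice hr).2.2 1
      have h2 : ∀ r ∈ Icc 0 F, ∫⁻ x, ‖iteratedFDeriv ℝ 2 (u r) x‖ₑ ^ 2 < ⊤ := fun r hr =>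
        (h.slice hr).2.2 2
      have h3 : ∀ r ∈ Icc 0 F, ∫⁻ x, ‖iteratedFDeriv ℝ 3 (u r) x‖ₑ ^ 2 < ⊤ := fun r hr =>
        (h.slice hr).2.2 3
      have hdis :=
        hV.dissip_le_of_synthVel hsyn (fun r hr => (h.slice hr).1) h1 h2 h3 le_rfl le_rfl
      have hlap := h.lintegral_laplacian_sq_le_of_tails hν hF hae hδ0.le hδ8 htail
      have hIoc : ∫⁻ r in Ioc 0 F, ∫⁻ x, ‖(Δ (u r)) x‖ₑ ^ 2 =
          ∫⁻ r in Ioo 0 F, ∫⁻ x, ‖(Δ (u r)) x‖ₑ ^ 2 := setLIntegral_congr Ioo_ae_eq_Ioc.symm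
      have hκle : ν⁻¹ * (1 + 4 * M ^ 2 * F / ν * Real.exp (2 * M ^ 2 * F / ν)) ≤ κw := by
        rw [hκw]
        refine mul_le_mul_of_nonneg_left ?_ (by positivity)
        have hexp : Real.exp (2 * M ^ 2 * F / ν) ≤ Real.exp (2 * M ^ 2 * Tw / ν) :=
          Real.exp_le_exp.2 (div_le_div_of_nonneg_right
            (mul_le_mul_of_nonneg_left hFw (by positivity)) hν.le)
        have h4 : 4 * M ^ 2 * F / ν ≤ 4 * M ^ 2 * Tw / ν :=
          div_le_div_of_nonneg_right (mul_le_mul_of_nonneg_left hFw (by positivity)) hν.le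
        have h5 : 0 ≤ 4 * M ^ 2 * F / ν := by positivity
        nlinarith [mul_le_mul h4 hexp (Real.exp_nonneg _) (h5.trans h4),
          Real.exp_nonneg (2 * M ^ 2 * F / ν)]
      calc dissip V 0 F ≤ ENNReal.ofReal (((2 * π) ^ 4)⁻¹) *
            ∫⁻ r in Ioc 0 F, ∫⁻ x, ‖(Δ (u r)) x‖ₑ ^ 2 := hdis
        _ ≤ ENNReal.ofReal (((2 * π) ^ 4)⁻¹) * (ENNReal.ofReal κw * ENNReal.ofReal g₀) := by
            rw [hIoc, ← hg₀eq]
            gcongr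
            exact hlap.trans (mul_le_mul_of_nonneg_right (ENNReal.ofReal_le_ofReal hκle) bot_le)
        _ = ENNReal.ofReal D := by
            rw [hD, ← ENNReal.ofReal_mul hκw0, ← ENNReal.ofReal_mul (by positivity)]
    -- the doubling argument
    have hVA₀ : HasDecay (Fintype.card (Fin 3) + 1) A₀ (V 0) := by rw [hV0]; exact hA₀
    have hdecay := hwindow hV hE hDis hVA₀ t' ht'
    rw [sub_zero] at hdecay
    refine hdecay.mono (mul_le_mul_of_nonneg_right ?_ hA₀0)
    exact pow_le_pow_right₀ one_le_two (Nat.ceil_le_ceil (div_le_div_of_nonneg_right hFw hτw.le))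
  /- the restart step -/
  have hstep : ∀ ⦃F : ℝ⦄ ⦃u : ℝ → EuclideanSpace ℝ (Fin 3) → EuclideanSpace ℝ (Fin 3)⦄
      ⦃p : ℝ → EuclideanSpace ℝ (Fin 3) → ℝ⦄ ⦃V : ℝ → EuclideanSpace ℝ (Fin 3) → Fin 3 → ℂ⦄,
      0 < F → F ≤ Tt → State F u p V →
      ∃ (F' : ℝ) (u' : ℝ → EuclideanSpace ℝ (Fin 3) → EuclideanSpace ℝ (Fin 3))
        (p' : ℝ → EuclideanSpace ℝ (Fin 3) → ℝ) (V' : ℝ → EuclideanSpace ℝ (Fin 3) → Fin 3 → ℂ),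
        (Tw ≤ F' ∨ F + TP / 2 ≤ F') ∧ F' ≤ Tw ∧ 0 < F' ∧ State F' u' p' V' := by
    intro F u p V hF hFT hS
    have hFw : F ≤ Tw := hFT.trans hTtw.le
    have hdecay := hbounds hF hFw hS
    obtain ⟨h, hV, hsyn, hV0⟩ := hS
    set t' : ℝ := max (F / 2) (F - TP / 4) with ht'
    have ht'0 : 0 ≤ t' := le_max_of_le_left (by linarith)
    have ht'F : t' < F := max_lt (by linarith) (by linarith)
    have hFt' : F ≤ t' + TP := by linarith [le_max_right (F / 2) (F - TP / 4)]
    have ht'I : t' ∈ Icc 0 F := ⟨ht'0, ht'F.le⟩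
    -- the restart piece from the Fourier-side state `V t'`
    have hdecAll : ∀ K : ℕ, ∃ B, HasDecay K B (V t') := fun K => by
      obtain ⟨B, hB⟩ := hV.decay K
      exact ⟨B, hB t'⟩
    obtain ⟨v, q, W, hv, hW, hvsyn, hW0⟩ := exists_isTaoSolutionOn_fourierPiece hν
      (hV.continuous_slice t') hdecAll (hdecay t' ht'I) (hV.divFree t') (hV.conjSymm t')
    rw [← hcF, ← hTP] at hv hW
    have hvt' : synthVel (V t') = u t' := (hsyn t' ht'I).symm
    rw [hvt'] at hv
    -- the physical glue
    have hglue := h.glue hv hν hTPpos ht'0 ht'F hFt'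
    -- the agreement on the overlap
    have hagree : ∀ s ∈ Ico 0 (min (F - t') TP), u (s + t') = v s :=
      (h.translate ht'0 ht'F).eq_of_isTaoSolutionOn hv hν (by linarith) hTPpos
    -- the Fourier glue
    have hW' : IsFourierMild cF (Fintype.card (Fin 3) + 1) t' (t' + TP) (fun t => W (t - t')) := by
      have := hW.translate t'
      simpa only [zero_add, add_comm TP t'] using this
    have hVt' : IsFourierMild cF (Fintype.card (Fin 3) + 1) 0 t' V := hV.mono le_rfl ht'0 ht'F.le
    have hjunction : V t' = (fun t => W (t - t')) t' := by simp only [sub_self, hW0]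
    have hGlueF := hVt'.glue hW' hjunction
    set F' : ℝ := min (t' + TP) Tw with hF'
    have hF'pos : 0 < F' := lt_min (by linarith) hTw0
    have hF'le : F' ≤ t' + TP := min_le_left _ _
    refine ⟨F', (fun t => if t < F then u t else v (t - t')),
      (fun t => if t < F then p t else q (t - t')), (fun t => if t ≤ t' then V t else W (t - t')),
      ?_, min_le_right _ _, hF'pos, ?_, ?_, ?_, ?_⟩
    · by_cases hcase : t' + TP ≤ Tw
      · right; rw [hF', min_eq_left hcase]; linarith [le_max_right (F / 2) (F - TP / 4)]
      · left; rw [hF', min_eq_right (le_of_not_ge hcase)]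
    · exact hglue.mono hF'pos hF'le
    · exact hGlueF.mono le_rfl hF'pos.le hF'le
    · -- synthesis at every time of `[0, F']`
      intro t ht
      by_cases htt' : t ≤ t'
      · have htF : t < F := lt_of_le_of_lt htt' ht'F
        simp only [if_pos htF, if_pos htt']
        exact hsyn t ⟨ht.1, htF.le⟩
      · have hgt : t' < t := not_le.1 htt'
        simp only [if_neg htt']
        by_cases htF : t < F
        · simp only [if_pos htF]
          have hs : t - t' ∈ Ico 0 (min (F - t') TP) :=
            ⟨by linarith, lt_min (by linarith) (by linarith [ht.2])⟩
          have := hagree (t - t') hs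
          rw [sub_add_cancel] at this
          rw [this, hvsyn]
        · simp only [if_neg htF]
          exact hvsyn (t - t')
    · -- the initial Fourier datum is unchanged
      show (if (0 : ℝ) ≤ t' then V 0 else W (0 - t')) = a₀
      rw [if_pos ht'0, hV0]
  /- the first state, from the Schwartz datum -/
  have hbase : ∃ (F : ℝ) (u : ℝ → EuclideanSpace ℝ (Fin 3) → EuclideanSpace ℝ (Fin 3))
      (p : ℝ → EuclideanSpace ℝ (Fin 3) → ℝ) (V : ℝ → EuclideanSpace ℝ (Fin 3) → Fin 3 → ℂ),
      0 < F ∧ F ≤ Tw ∧ State F u p V := by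
    obtain ⟨u, p, V, hu, hV, hsyn, hV0⟩ := exists_isTaoSolutionOn_fourierPiece hν
      (continuous_fourierData hsm hdec) (hasDecay_fourierData hsm hdec) hA₀ hdiv' hconj₀
    rw [hsynth₀] at hu
    set T₀ : ℝ := picardTime (Fin 3) (4 * π ^ 2 * ν) (Fintype.card (Fin 3) + 1) (2 * A₀) with hT₀
    have hT₀pos : 0 < T₀ := picardTime_pos hcF0 _ _ (by positivity)
    set F₀ : ℝ := min T₀ Tw with hF₀
    have hF₀pos : 0 < F₀ := lt_min hT₀pos hTw0
    refine ⟨F₀, u, p, V, hF₀pos, min_le_right _ _, ?_, ?_, ?_, hV0⟩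
    · exact hu.mono hF₀pos (min_le_left _ _)
    · exact hV.mono le_rfl hF₀pos.le (min_le_left _ _)
    · exact fun t _ => hsyn t
  /- the induction -/
  have hiter : ∀ k : ℕ, ∃ (F : ℝ) (u : ℝ → EuclideanSpace ℝ (Fin 3) → EuclideanSpace ℝ (Fin 3))
      (p : ℝ → EuclideanSpace ℝ (Fin 3) → ℝ) (V : ℝ → EuclideanSpace ℝ (Fin 3) → Fin 3 → ℂ),
      0 < F ∧ F ≤ Tw ∧ State F u p V ∧ (Tt ≤ F ∨ (k : ℝ) * (TP / 2) ≤ F) := by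
    intro k
    induction k with
    | zero =>
      obtain ⟨F, u, p, V, hF, hFw, hS⟩ := hbase
      exact ⟨F, u, p, V, hF, hFw, hS, Or.inr (by simpa using hF.le)⟩
    | succ k ih =>
      obtain ⟨F, u, p, V, hF, hFw, hS, halt⟩ := ih
      rcases le_or_gt Tt F with hdone | hlt
      · exact ⟨F, u, p, V, hF, hFw, hS, Or.inl hdone⟩
      · obtain ⟨F', u', p', V', hprog, hF'w, hF'pos, hS'⟩ := hstep hF hlt.le hS
        refine ⟨F', u', p', V', hF'pos, hF'w, hS', ?_⟩
        rcases hprog with hTw' | hadv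
        · exact Or.inl (hTtw.le.trans hTw')
        · rcases halt with hd | hk
          · exact absurd hd (not_le.2 hlt)
          · right
            push_cast
            linarith
  obtain ⟨k, hk⟩ := exists_nat_gt (Tw / (TP / 2))
  obtain ⟨F, u, p, V, hF, hFw, hS, halt⟩ := hiter k
  have hTtF : Tt ≤ F := by
    rcases halt with hd | hk'
    · exact hd
    · exfalso
      have h2 : Tw < (k : ℝ) * (TP / 2) := by rwa [div_lt_iff₀ (by positivity)] at hk
      linarith
  /- the whole state, restricted to `[0, Tt]` -/
  obtain ⟨h, hV, hsyn, hV0⟩ := hS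
  have e4 : Fintype.card (Fin 3) + 1 = 4 := by simp
  have hVTt : IsFourierMild cF (Fintype.card (Fin 3) + 1) 0 Tt V := hV.mono le_rfl hTt.le hTtF
  rw [e4] at hVTt
  exact ⟨u, p, V, h.mono hTt hTtF, hVTt, fun t ht => hsyn t ⟨ht.1, ht.2.trans hTtF⟩, hV0⟩

end Summit.NavierStokesRegularity.NavierStokesRegularity.Theorems.BoundedEnvelope

end
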